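import Summits.CriticalPhenomena.Ising3DConformalLimit.Theses.PerfectScreening
import Literature.Probability.LatticeModels.LatticeGreenAsymptotics

/-!
# PerfectScreening · `GreenAsymptotics` (item `stmt-CriticalPhenomena-1345`), proved

Route `CriticalPhenomena/Ising3DConformalLimit/PerfectScreening`, support item `GreenAsymptotics`:
with `G₀(x) := (2(2π)³)⁻¹ ∫_{[-π,π]³} cos(p·x)/Σᵢ(1 − cos pᵢ) dp` (the Green function of the graph
Laplacian of `ℤ³`), there are `a > 0` and `K` with `|G₀(x) − a/|x|₂| ≤ K/|x|₂²` for all `x ≠ 0`.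

PROOF. The inline integral is `latticeGreen x` of
`Literature/Probability/LatticeModels/LatticeGreenFunction.lean` unfolded (`brillouin 3 = [-π,π]³`,
`dispersion p = Σᵢ(1 − cos pᵢ)`), so `G₀ = latticeGreen/2`; the tree theorem
`Literature.Probability.LatticeModels.latticeGreen_asymptotics` (Lawler–Limic 2010, Thm. 4.3.1) at
`d = 3` gives `|latticeGreen x − Γ(1/2)/(2π^{3/2})·|x|⁻¹| ≤ K|x|⁻³`, and `Γ(1/2)/(2π^{3/2}) = 1/(2π)`,
`|x|⁻³ ≤ |x|⁻²` (`|x| ≥ 1` on `ℤ³ ∖ {0}`). Hence `a = 1/(4π)` and the constant `|K|/2`.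

References: G. F. Lawler, V. Limic, *Random Walk: A Modern Introduction* (CUP 2010), Thm. 4.3.1;
G. F. Lawler, *Intersections of Random Walks* (1991), Thm. 1.5.4.
-/

namespace Summit.CriticalPhenomena.Ising3DConformalLimit.Theorems

open Literature.Probability.LatticeModels MeasureTheory

/-- **Green asymptotics on `ℤ³`** (settles `stmt-CriticalPhenomena-1345`, exact route decl
`PerfectScreening.GreenAsymptotics`): there are `a > 0` (namely `a = 1/(4π)`) and `K` such that
`|(2(2π)³)⁻¹ ∫_{[-π,π]³} cos(p·x)/Σᵢ(1 − cos pᵢ) dp − a/√(Σᵢxᵢ²)| ≤ K/Σᵢxᵢ²` for every `x ∈ ℤ³ ∖ {0}`.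
Specialisation `d = 3` of `Literature.Probability.LatticeModels.latticeGreen_asymptotics`
(Lawler–Limic 2010, Thm. 4.3.1, remainder `O(|x|⁻³)` weakened to `O(|x|⁻²)`). -/
theorem GreenAsymptotics_proof :
    Summit.CriticalPhenomena.Ising3DConformalLimit.Theses.PerfectScreening.GreenAsymptotics := by
  unfold Theses.PerfectScreening.GreenAsymptotics
  obtain ⟨K, hK⟩ := latticeGreen_asymptotics (d := 3) le_rfl
  refine ⟨1 / (4 * Real.pi), |K| / 2, by positivity, fun x hx => ?_⟩
  have h := hK x hx
  -- the Euclidean norm `r = √S ≥ 1`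
  set S : ℝ := ∑ i, ((x i : ℤ) : ℝ) ^ 2 with hS
  set r : ℝ := Real.sqrt S with hr
  have hr1 : 1 ≤ r := one_le_sqrt_sum_sq_of_ne_zero hx
  have hr0 : 0 < r := by linarith
  have hrS : r ^ 2 = S := Real.sq_sqrt (by positivity)
  -- the inline integral is `latticeGreen x`
  have hG : (∫ p in Set.pi Set.univ (fun _ : Fin 3 => Set.Icc (-Real.pi) Real.pi),
      Real.cos (∑ i, p i * (x i : ℝ)) / (∑ i, (1 - Real.cos (p i)))) / (2 * (2 * Real.pi) ^ 3) =
      latticeGreen x / 2 := by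
    unfold latticeGreen brillouin dispersion
    ring
  rw [hG]
  -- the constant: `Γ(1/2)/(2π^{3/2}) = 1/(2π)`
  have hpi : 0 < Real.pi := Real.pi_pos
  have hc : Real.Gamma (((3 : ℕ) : ℝ) / 2 - 1) / (2 * Real.pi ^ (((3 : ℕ) : ℝ) / 2)) =
      1 / (2 * Real.pi) := by
    have h32 : Real.pi ^ (((3 : ℕ) : ℝ) / 2) = Real.pi * Real.sqrt Real.pi := by
      rw [show ((3 : ℕ) : ℝ) / 2 = 1 + 1 / 2 by norm_num, Real.rpow_add hpi, Real.rpow_one,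
        Real.sqrt_eq_rpow]
    rw [show ((3 : ℕ) : ℝ) / 2 - 1 = 1 / 2 by norm_num, Real.Gamma_one_half_eq, h32]
    have hsq : 0 < Real.sqrt Real.pi := Real.sqrt_pos.mpr hpi
    field_simp
  -- the powers: `r^{2-3} = r⁻¹`, `r^{-3} ≤ (r²)⁻¹`
  have h1 : r ^ ((2 : ℝ) - ((3 : ℕ) : ℝ)) = r⁻¹ := by
    rw [show (2 : ℝ) - ((3 : ℕ) : ℝ) = -1 by norm_num, Real.rpow_neg_one]
  have h2 : r ^ (-(((3 : ℕ) : ℝ))) ≤ (r ^ 2)⁻¹ := by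
    have : (r ^ 2)⁻¹ = r ^ (-(2 : ℝ)) := by
      rw [Real.rpow_neg hr0.le, Real.rpow_two]
    rw [this]
    exact Real.rpow_le_rpow_of_exponent_le hr1 (by norm_num)
  rw [hc, h1] at h
  have h0 : 0 ≤ r ^ (-(((3 : ℕ) : ℝ))) := Real.rpow_nonneg hr0.le _
  calc |latticeGreen x / 2 - 1 / (4 * Real.pi) / r|
      = |latticeGreen x - 1 / (2 * Real.pi) * r⁻¹| / 2 := by
        rw [show latticeGreen x / 2 - 1 / (4 * Real.pi) / r
            = (latticeGreen x - 1 / (2 * Real.pi) * r⁻¹) / 2 by ring, abs_div, abs_two]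
    _ ≤ K * r ^ (-(((3 : ℕ) : ℝ))) / 2 := by gcongr
    _ ≤ |K| * r ^ (-(((3 : ℕ) : ℝ))) / 2 := by gcongr; exact le_abs_self K
    _ ≤ |K| * (r ^ 2)⁻¹ / 2 := by gcongr
    _ = |K| / 2 / S := by rw [hrS]; ring
      
end Summit.CriticalPhenomena.Ising3DConformalLimit.Theorems
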